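import Literature.Analysis.FluidPDE.SereginSverakPressureMonotone
import HarnessLib

/-!
# One-sided pressure bounds: the tangential (log-weighted) energy bound

Analysis/FluidPDE proof file (theorems only; no definitions, no named facts) on the discharge
path of `Literature.Analysis.FluidPDE.seregin_sverak_2002` (G. Seregin, V. Šverák,
*Navier–Stokes equations with lower bounds on the pressure*, ARMA **163** (2002) 65–86).

With the probe pair `(P, P̄)` of `SereginSverakPressureMonotone.lean` (`P̄ + (2/3)σP̄' = P`),
the pressure identity of that file at centre `x₀` and scale `s`,
`3∫ p̃ P_s = -∫ (2 s⁻² P̄'(σ) ⟨x - x₀, w⟩² + P̄(σ)|w|²)`, `σ = |x - x₀|²/s²`, has the **exact** form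

  `∫ |w|² (2P̄_s - 3P_s) = 3 ∫ p̃ P_s + ∫ D_s`,
  `D_s(x) = 2(-P̄'(σ)) s⁻² (|x - x₀|²|w|² - ⟨x - x₀, w⟩²) ≥ 0`

(`integral_kernel_eq_pressure_add_tangential`): the defect `D_s` only sees the **tangential**
part `|x - x₀|²|w|² - ⟨x - x₀, w⟩² = |x - x₀|² |w_τ|²` of the field. Integrating `s⁻² ds` over the
scales `s ∈ (r, S)` (the monotone scaled energy `E(s) = ∫ |w|² s⁻¹ P̄_s` of that file,
`E(S) - E(r) = ∫_r^S s⁻² ∫ |w|²(2P̄_s - 3P_s)`), a pressure floor `p̃ ≥ -K` on `B(x₀, S)` gives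
`∫_r^S s⁻² ∫ D_s ds ≤ E(S) + (3/2) K c_P S²`, while for `|x - x₀| = ρ ≥ 2r` the inner scale
integral is explicit (`P̄(σ) = P̄(1) σ^{-3/2}` for `σ ≥ 1`): `∫_r^ρ s⁻² D_s ds ≥ (9/8) P̄(1) |w_τ|²/ρ`.
Hence the **log-weighted tangential energy bound**

* `SereginSverak2002.lintegral_tangential_le` —
  `∫_{2r ≤ |x-x₀| ≤ S} |w_τ(x)|² / |x - x₀| dx ≤ (8 / (9 P̄(1))) (E(S) + (3/2) K c_P S²)`

for smooth finite-energy fields with `p̃[w] ≥ -K` on `B(x₀, S)` (stated with a lower Lebesgue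
integral; `|w_τ|² = |w|² - ⟨x - x₀, w⟩²/|x - x₀|²`). This is the mechanism making blow-up limits
at a point of the final slice *radial* in Seregin–Šverák's argument (§4).

## References

* G. Seregin, V. Šverák, Arch. Ration. Mech. Anal. 163 (2002), 65–86, §§3–4. [SereginSverak2002]
-/

noncomputable section

open MeasureTheory Set Filter Metric Topology Function Real
open scoped ENNReal NNReal RealInnerProductSpace ContDiff

namespace Literature.Analysis.FluidPDE

namespace SereginSverak2002

variable {P Pb : ℝ → ℝ}

/-! ### The exact pressure–tangential identity at one scale -/

section OneScale

/-- Cauchy–Schwarz: the tangential defect `|x - x₀|²|w|² - ⟨x - x₀, w⟩²` is nonnegative. [folklore] -/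
theorem tangentialDefect_nonneg (v y : EuclideanSpace ℝ (Fin 3)) :
    0 ≤ ‖y‖ ^ 2 * ‖v‖ ^ 2 - ⟪y, v⟫ ^ 2 := by
  have h0 := abs_real_inner_le_norm y v
  have : ⟪y, v⟫ ^ 2 ≤ (‖y‖ * ‖v‖) ^ 2 := by
    calc ⟪y, v⟫ ^ 2 = |⟪y, v⟫| ^ 2 := (sq_abs _).symm
      _ ≤ (‖y‖ * ‖v‖) ^ 2 := pow_le_pow_left₀ (abs_nonneg _) h0 2
  nlinarith

/-- **The exact identity at scale `s`**:
`∫ |w|²(2P̄_s - 3P_s) - 3∫ p̃ P_s = ∫ 2(-P̄'(σ)) s⁻² (|x-x₀|²|w|² - ⟨x-x₀,w⟩²)`, together with the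
integrability of the (nonnegative) defect integrand. [cite: SereginSverak2002, §3] -/
theorem integral_kernel_eq_pressure_add_tangential (hP : ContDiff ℝ ∞ P) (hPb : ContDiff ℝ ∞ Pb)
    (hode : ∀ σ, Pb σ + 2 / 3 * σ * deriv Pb σ = P σ) (hP0 : ∀ σ, 1 ≤ σ → P σ = 0)
    (hPnn : ∀ σ, 0 ≤ P σ) (hPle : ∀ σ, P σ ≤ Pb σ) (hPble : ∀ σ, Pb σ ≤ 1)
    {w : EuclideanSpace ℝ (Fin 3) → EuclideanSpace ℝ (Fin 3)}
    (hw : ContDiff ℝ ∞ w) (hL2 : Integrable fun y => ‖w y‖ ^ 2)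
    (x₀ : EuclideanSpace ℝ (Fin 3)) {s : ℝ} (hs : 0 < s) :
    Integrable (fun x => 2 * (-deriv Pb (‖x - x₀‖ ^ 2 / s ^ 2)) / s ^ 2 *
        (‖x - x₀‖ ^ 2 * ‖w x‖ ^ 2 - ⟪x - x₀, w x⟫ ^ 2)) ∧
    (∫ x, ‖w x‖ ^ 2 * (2 * Pb (‖x - x₀‖ ^ 2 / s ^ 2) - 3 * P (‖x - x₀‖ ^ 2 / s ^ 2))) -
        3 * ∫ x, normalisedPressure w x * P (‖x - x₀‖ ^ 2 / s ^ 2) =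
      ∫ x, 2 * (-deriv Pb (‖x - x₀‖ ^ 2 / s ^ 2)) / s ^ 2 *
        (‖x - x₀‖ ^ 2 * ‖w x‖ ^ 2 - ⟪x - x₀, w x⟫ ^ 2) := by
  have hPbnn : ∀ σ, 0 ≤ Pb σ := fun σ => (hPnn σ).trans (hPle σ)
  have hid := integral_normalisedPressure_mul_probe_scaled hP hPb hode hP0 hPnn hPle hPble hw hL2 x₀ hs
  have hwc : Continuous w := hw.continuous
  have hn : Continuous fun x : EuclideanSpace ℝ (Fin 3) => ‖x - x₀‖ ^ 2 / s ^ 2 :=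
    ((continuous_id.sub continuous_const).norm.pow 2).div_const _
  have hPb'c : Continuous (deriv Pb) := hPb.continuous_deriv (by simp)
  set A₁ : EuclideanSpace ℝ (Fin 3) → ℝ := fun x =>
    2 / 3 * (deriv Pb (‖x - x₀‖ ^ 2 / s ^ 2) / s ^ 2) * ⟪x - x₀, w x⟫ ^ 2 +
      1 / 3 * Pb (‖x - x₀‖ ^ 2 / s ^ 2) * ‖w x‖ ^ 2 with hA₁
  set A₂ : EuclideanSpace ℝ (Fin 3) → ℝ := fun x =>
    ‖w x‖ ^ 2 * (2 * Pb (‖x - x₀‖ ^ 2 / s ^ 2) - 3 * P (‖x - x₀‖ ^ 2 / s ^ 2)) with hA₂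
  set D : EuclideanSpace ℝ (Fin 3) → ℝ := fun x => 2 * (-deriv Pb (‖x - x₀‖ ^ 2 / s ^ 2)) / s ^ 2 *
    (‖x - x₀‖ ^ 2 * ‖w x‖ ^ 2 - ⟪x - x₀, w x⟫ ^ 2) with hD
  have hτnn : ∀ x : EuclideanSpace ℝ (Fin 3), 0 ≤ ‖x - x₀‖ ^ 2 / s ^ 2 := fun x => by positivity
  have hkey : ∀ x : EuclideanSpace ℝ (Fin 3),
      |deriv Pb (‖x - x₀‖ ^ 2 / s ^ 2) / s ^ 2 * ⟪x - x₀, w x⟫ ^ 2| ≤ 3 * ‖w x‖ ^ 2 := by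
    intro x
    have hcs : ⟪x - x₀, w x⟫ ^ 2 ≤ ‖x - x₀‖ ^ 2 * ‖w x‖ ^ 2 := by
      linarith [tangentialDefect_nonneg (w x) (x - x₀)]
    have h3 := abs_deriv_mul_le_three hode hPnn hPle hPble (hτnn x)
    rw [abs_mul, abs_div, abs_of_nonneg (sq_nonneg ⟪x - x₀, w x⟫), abs_of_nonneg (sq_nonneg s)]
    calc |deriv Pb (‖x - x₀‖ ^ 2 / s ^ 2)| / s ^ 2 * ⟪x - x₀, w x⟫ ^ 2
        ≤ |deriv Pb (‖x - x₀‖ ^ 2 / s ^ 2)| / s ^ 2 * (‖x - x₀‖ ^ 2 * ‖w x‖ ^ 2) := by gcongr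
      _ = |deriv Pb (‖x - x₀‖ ^ 2 / s ^ 2)| * (‖x - x₀‖ ^ 2 / s ^ 2) * ‖w x‖ ^ 2 := by
          field_simp
      _ ≤ 3 * ‖w x‖ ^ 2 := by gcongr
  have hA₁int : Integrable A₁ := by
    refine (hL2.const_mul 3).mono' ?_ (Eventually.of_forall fun x => ?_)
    · exact ((continuous_const.mul ((hPb'c.comp hn).div_const _)).mul
        (((continuous_id.sub continuous_const).inner hwc).pow 2)).add
        ((continuous_const.mul (hPb.continuous.comp hn)).mul (hwc.norm.pow 2)) |>.aestronglyMeasurable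
    · rw [Real.norm_eq_abs]
      simp only [hA₁]
      have h2 : |1 / 3 * Pb (‖x - x₀‖ ^ 2 / s ^ 2) * ‖w x‖ ^ 2| ≤ 1 * ‖w x‖ ^ 2 := by
        rw [abs_mul, abs_mul, abs_of_nonneg (by norm_num : (0 : ℝ) ≤ 1 / 3),
          abs_of_nonneg (hPbnn _), abs_of_nonneg (sq_nonneg _)]
        calc 1 / 3 * Pb (‖x - x₀‖ ^ 2 / s ^ 2) * ‖w x‖ ^ 2 ≤ 1 / 3 * 1 * ‖w x‖ ^ 2 := by
              gcongr; exact hPble _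
          _ ≤ 1 * ‖w x‖ ^ 2 := by nlinarith [sq_nonneg ‖w x‖]
      calc |2 / 3 * (deriv Pb (‖x - x₀‖ ^ 2 / s ^ 2) / s ^ 2) * ⟪x - x₀, w x⟫ ^ 2 +
            1 / 3 * Pb (‖x - x₀‖ ^ 2 / s ^ 2) * ‖w x‖ ^ 2|
          ≤ |2 / 3 * (deriv Pb (‖x - x₀‖ ^ 2 / s ^ 2) / s ^ 2) * ⟪x - x₀, w x⟫ ^ 2| +
            |1 / 3 * Pb (‖x - x₀‖ ^ 2 / s ^ 2) * ‖w x‖ ^ 2| := abs_add_le _ _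
        _ ≤ 2 / 3 * (3 * ‖w x‖ ^ 2) + 1 * ‖w x‖ ^ 2 := by
            refine add_le_add ?_ h2
            rw [mul_assoc, abs_mul, abs_of_nonneg (by norm_num : (0 : ℝ) ≤ 2 / 3)]
            gcongr
            exact hkey x
        _ = 3 * ‖w x‖ ^ 2 := by ring
  have hA₂int : Integrable A₂ := by
    refine (hL2.mul_const 5).mono' ?_ (Eventually.of_forall fun x => ?_)
    · exact ((hwc.norm.pow 2).mul ((continuous_const.mul (hPb.continuous.comp hn)).sub
        (continuous_const.mul (hP.continuous.comp hn)))).aestronglyMeasurable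
    · rw [Real.norm_eq_abs]
      simp only [hA₂]
      rw [abs_mul, abs_of_nonneg (sq_nonneg _)]
      gcongr
      rw [abs_le]; constructor <;> nlinarith [hPbnn (‖x - x₀‖ ^ 2 / s ^ 2),
        hPble (‖x - x₀‖ ^ 2 / s ^ 2), hPnn (‖x - x₀‖ ^ 2 / s ^ 2), hPle (‖x - x₀‖ ^ 2 / s ^ 2)]
  -- the pointwise identity `A₂ + 3 A₁ = D`
  have hpt : ∀ x, A₂ x + 3 * A₁ x = D x := by
    intro x
    simp only [hA₁, hA₂, hD]
    set τ : ℝ := ‖x - x₀‖ ^ 2 / s ^ 2 with hτ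
    have hodeτ := hode τ
    have hs2 : (s ^ 2) ≠ 0 := by positivity
    rw [← hodeτ, hτ]
    field_simp
    ring
  have hDint : Integrable D := by
    have := hA₂int.add (hA₁int.const_mul 3)
    refine this.congr (Eventually.of_forall fun x => ?_)
    exact hpt x
  refine ⟨hDint, ?_⟩
  rw [hid]
  have e1 : (∫ x, A₂ x) - 3 * -∫ x, A₁ x = ∫ x, (A₂ x + 3 * A₁ x) := by
    rw [integral_add hA₂int (hA₁int.const_mul 3), integral_const_mul]; ring
  rw [e1]
  exact integral_congr_ae (Eventually.of_forall hpt)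

/-- Under a pressure floor `p̃ ≥ -K` on `B(x₀, S)`: `-3∫ p̃ P_s ≤ 3 K c_P s³` for `0 < s ≤ S`
(`c_P = ∫ P(|y|²) dy`). [folklore] -/
theorem neg_integral_pressure_probe_le_of_floor (hP : ContDiff ℝ ∞ P)
    (hP0 : ∀ σ, 1 ≤ σ → P σ = 0) (hPnn : ∀ σ, 0 ≤ P σ)
    {w : EuclideanSpace ℝ (Fin 3) → EuclideanSpace ℝ (Fin 3)}
    (hw : ContDiff ℝ ∞ w) (hL2 : Integrable fun y => ‖w y‖ ^ 2)
    (x₀ : EuclideanSpace ℝ (Fin 3)) {K S s : ℝ}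
    (hfloor : ∀ x ∈ ball x₀ S, -K ≤ normalisedPressure w x) (hs : 0 < s) (hsS : s ≤ S) :
    -(3 * ∫ x, normalisedPressure w x * P (‖x - x₀‖ ^ 2 / s ^ 2)) ≤
      3 * K * (∫ y : EuclideanSpace ℝ (Fin 3), P (‖y‖ ^ 2)) * s ^ 3 := by
  have hpc := continuous_normalisedPressure_of_integrable hw hL2
  have hn : Continuous fun x : EuclideanSpace ℝ (Fin 3) => ‖x - x₀‖ ^ 2 / s ^ 2 :=
    ((continuous_id.sub continuous_const).norm.pow 2).div_const _
  have hPsc : Continuous fun x : EuclideanSpace ℝ (Fin 3) => P (‖x - x₀‖ ^ 2 / s ^ 2) :=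
    hP.continuous.comp hn
  have hPs0 : ∀ x : EuclideanSpace ℝ (Fin 3), x ∉ closedBall x₀ s → P (‖x - x₀‖ ^ 2 / s ^ 2) = 0 := by
    intro x hx
    rw [mem_closedBall, dist_eq_norm, not_le] at hx
    refine hP0 _ ?_
    rw [le_div_iff₀ (by positivity)]
    nlinarith [norm_nonneg (x - x₀)]
  have hsupp : HasCompactSupport fun x : EuclideanSpace ℝ (Fin 3) => P (‖x - x₀‖ ^ 2 / s ^ 2) :=
    HasCompactSupport.intro (isCompact_closedBall x₀ s) hPs0
  have hPint : Integrable fun x : EuclideanSpace ℝ (Fin 3) => P (‖x - x₀‖ ^ 2 / s ^ 2) :=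
    hPsc.integrable_of_hasCompactSupport hsupp
  have hpPint : Integrable fun x => normalisedPressure w x * P (‖x - x₀‖ ^ 2 / s ^ 2) :=
    (hpc.mul hPsc).integrable_of_hasCompactSupport hsupp.mul_left
  have hpt : ∀ x, -K * P (‖x - x₀‖ ^ 2 / s ^ 2) ≤ normalisedPressure w x * P (‖x - x₀‖ ^ 2 / s ^ 2) := by
    intro x
    by_cases hx : x ∈ ball x₀ S
    · exact mul_le_mul_of_nonneg_right (hfloor x hx) (hPnn _)
    · have : P (‖x - x₀‖ ^ 2 / s ^ 2) = 0 := by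
        refine hP0 _ ?_
        rw [mem_ball, dist_eq_norm, not_lt] at hx
        rw [le_div_iff₀ (by positivity)]
        nlinarith [norm_nonneg (x - x₀), hsS]
      rw [this, mul_zero, mul_zero]
  have h := integral_mono (hPint.const_mul (-K)) hpPint hpt
  rw [integral_const_mul, integral_probe_scaled P x₀ hs] at h
  linarith

end OneScale

/-! ### The probe beyond its plateau: `P̄(σ) = P̄(1) σ^{-3/2}` for `σ ≥ 1` -/

section Tail

/-- For `0 < s ≤ ρ`: `P̄(ρ²/s²) = P̄(1) s³/ρ³`. [folklore] -/
theorem probe_eq_of_le (hPb : Differentiable ℝ Pb)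
    (hode : ∀ σ, Pb σ + 2 / 3 * σ * deriv Pb σ = P σ) (hP0 : ∀ σ, 1 ≤ σ → P σ = 0)
    (hPbpos : ∀ σ, 0 < Pb σ) {s ρ : ℝ} (hs : 0 < s) (hsρ : s ≤ ρ) :
    Pb (ρ ^ 2 / s ^ 2) = Pb 1 * s ^ 3 / ρ ^ 3 := by
  have hρ : 0 < ρ := lt_of_lt_of_le hs hsρ
  have hσ1 : 1 ≤ ρ ^ 2 / s ^ 2 := by
    rw [le_div_iff₀ (by positivity)]
    nlinarith
  have h := probe_sq_mul_cube_eq hPb hode hP0 hσ1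
  -- both sides are positive with equal squares
  have h1 : 0 < Pb (ρ ^ 2 / s ^ 2) := hPbpos _
  have h2 : 0 < Pb 1 * s ^ 3 / ρ ^ 3 := by have := hPbpos 1; positivity
  have hsq : Pb (ρ ^ 2 / s ^ 2) ^ 2 = (Pb 1 * s ^ 3 / ρ ^ 3) ^ 2 := by
    have e : (ρ ^ 2 / s ^ 2) ^ 3 = ρ ^ 6 / s ^ 6 := by field_simp
    rw [e] at h
    field_simp at h
    field_simp
    nlinarith [h]
  nlinarith [sq_nonneg (Pb (ρ ^ 2 / s ^ 2) - Pb 1 * s ^ 3 / ρ ^ 3),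
    sq_nonneg (Pb (ρ ^ 2 / s ^ 2) + Pb 1 * s ^ 3 / ρ ^ 3)]

/-- For `0 < s ≤ ρ`: the scale density of the defect is explicit,
`s⁻² · 2(-P̄'(ρ²/s²)) s⁻² = 3 P̄(1) s/ρ⁵`. [folklore] -/
theorem inv_sq_mul_defectWeight_eq (hPb : Differentiable ℝ Pb)
    (hode : ∀ σ, Pb σ + 2 / 3 * σ * deriv Pb σ = P σ) (hP0 : ∀ σ, 1 ≤ σ → P σ = 0)
    (hPbpos : ∀ σ, 0 < Pb σ) {s ρ : ℝ} (hs : 0 < s) (hsρ : s ≤ ρ) :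
    (s ^ 2)⁻¹ * (2 * (-deriv Pb (ρ ^ 2 / s ^ 2)) / s ^ 2) = 3 * Pb 1 * s / ρ ^ 5 := by
  have hρ : 0 < ρ := lt_of_lt_of_le hs hsρ
  have hσ1 : 1 ≤ ρ ^ 2 / s ^ 2 := by
    rw [le_div_iff₀ (by positivity)]
    nlinarith
  -- from the ODE with `P = 0`: `P̄'(σ) = -(3/2) P̄(σ)/σ`
  have hODE := hode (ρ ^ 2 / s ^ 2)
  rw [hP0 _ hσ1] at hODE
  have hPbσ := probe_eq_of_le hPb hode hP0 hPbpos hs hsρ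
  have hd : deriv Pb (ρ ^ 2 / s ^ 2) = -(3 / 2) * (Pb 1 * s ^ 3 / ρ ^ 3) / (ρ ^ 2 / s ^ 2) := by
    rw [← hPbσ]
    have hσ0 : ρ ^ 2 / s ^ 2 ≠ 0 := by positivity
    field_simp
    field_simp at hODE
    linarith
  rw [hd]
  field_simp

/-- The inner scale integral for `ρ ≥ 2r`: `∫_{s ∈ (r, ρ)} 3P̄(1) s/ρ⁵ ds ≥ (9/8) P̄(1)/ρ³`
(as a lower Lebesgue integral). [folklore] -/
theorem lintegral_scale_lower (hPb1 : 0 < Pb 1) {r ρ : ℝ} (hr : 0 < r) (hρ : 2 * r ≤ ρ) :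
    ENNReal.ofReal (9 / 8 * Pb 1 / ρ ^ 3) ≤
      ∫⁻ s in Ioo r ρ, ENNReal.ofReal (3 * Pb 1 * s / ρ ^ 5) := by
  have hρ0 : 0 < ρ := by linarith
  have hint : IntegrableOn (fun s : ℝ => 3 * Pb 1 * s / ρ ^ 5) (Ioo r ρ) := by
    refine (continuous_const.mul continuous_id).div_const _ |>.integrableOn_Icc.mono_set Ioo_subset_Icc_self
  rw [← ofReal_integral_eq_lintegral_ofReal hint (by
    filter_upwards [ae_restrict_mem measurableSet_Ioo] with s hs
    have : 0 < s := hr.trans hs.1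
    positivity)]
  refine ENNReal.ofReal_le_ofReal ?_
  have e : ∫ s in Ioo r ρ, 3 * Pb 1 * s / ρ ^ 5 = 3 * Pb 1 / ρ ^ 5 * ((ρ ^ 2 - r ^ 2) / 2) := by
    rw [← integral_Ioc_eq_integral_Ioo, ← intervalIntegral.integral_of_le (by linarith : r ≤ ρ)]
    have : ∫ s in r..ρ, 3 * Pb 1 * s / ρ ^ 5 = 3 * Pb 1 / ρ ^ 5 * ∫ s in r..ρ, s := by
      rw [← intervalIntegral.integral_const_mul]
      refine intervalIntegral.integral_congr fun s _ => ?_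
      ring
    rw [this, integral_id]
  rw [e]
  have h34 : 3 / 4 * ρ ^ 2 ≤ ρ ^ 2 - r ^ 2 := by nlinarith
  calc 9 / 8 * Pb 1 / ρ ^ 3 = 3 * Pb 1 / ρ ^ 5 * (3 / 4 * ρ ^ 2 / 2) := by field_simp; ring
    _ ≤ 3 * Pb 1 / ρ ^ 5 * ((ρ ^ 2 - r ^ 2) / 2) := by gcongr

end Tail

/-! ### The log-weighted tangential energy bound -/

section Main

/-- **The tangential energy bound** (see the module docstring): for a smooth finite-energy
field with `p̃[w] ≥ -K` on `B(x₀, S)` and `0 < 2r ≤ S`,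
`∫_{2r ≤ |x-x₀| ≤ S} |w_τ|²/|x-x₀| ≤ (8/(9P̄(1))) (E(S) + (3/2) K c_P S²)`,
`E(S) = ∫ |w|² S⁻¹ P̄(|x-x₀|²/S²)`, `c_P = ∫ P(|y|²) dy`. [cite: SereginSverak2002, §3] -/
theorem lintegral_tangential_le (hP : ContDiff ℝ ∞ P) (hPb : ContDiff ℝ ∞ Pb)
    (hode : ∀ σ, Pb σ + 2 / 3 * σ * deriv Pb σ = P σ) (hP0 : ∀ σ, 1 ≤ σ → P σ = 0)
    (hPnn : ∀ σ, 0 ≤ P σ) (hPle : ∀ σ, P σ ≤ Pb σ) (hPble : ∀ σ, Pb σ ≤ 1)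
    (hPb' : ∀ σ, deriv Pb σ ≤ 0) (hPbpos : ∀ σ, 0 < Pb σ)
    {w : EuclideanSpace ℝ (Fin 3) → EuclideanSpace ℝ (Fin 3)}
    (hw : ContDiff ℝ ∞ w) (hL2 : Integrable fun y => ‖w y‖ ^ 2)
    (x₀ : EuclideanSpace ℝ (Fin 3)) {K r S : ℝ} (hK : 0 ≤ K) (hr : 0 < r) (hrS : 2 * r ≤ S)
    (hfloor : ∀ x ∈ ball x₀ S, -K ≤ normalisedPressure w x) :
    ∫⁻ x in {x : EuclideanSpace ℝ (Fin 3) | 2 * r ≤ ‖x - x₀‖ ∧ ‖x - x₀‖ ≤ S},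
        ENNReal.ofReal ((‖w x‖ ^ 2 - ⟪x - x₀, w x⟫ ^ 2 / ‖x - x₀‖ ^ 2) / ‖x - x₀‖) ≤
      ENNReal.ofReal (8 / (9 * Pb 1) *
        ((∫ x, ‖w x‖ ^ 2 * (S⁻¹ * Pb (‖x - x₀‖ ^ 2 / S ^ 2))) +
          3 / 2 * K * (∫ y : EuclideanSpace ℝ (Fin 3), P (‖y‖ ^ 2)) * S ^ 2)) := by
  have hPbnn : ∀ σ, 0 ≤ Pb σ := fun σ => (hPnn σ).trans (hPle σ)
  have hrS' : r ≤ S := by linarith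
  have hS : 0 < S := by linarith
  have hwc : Continuous w := hw.continuous
  have hwm : Measurable w := hwc.measurable
  have hPbm : Measurable Pb := hPb.continuous.measurable
  have hPm : Measurable P := hP.continuous.measurable
  have hPb'm : Measurable (deriv Pb) := (hPb.continuous_deriv (by simp)).measurable
  set cP : ℝ := ∫ y : EuclideanSpace ℝ (Fin 3), P (‖y‖ ^ 2) with hcP
  have hcP0 : 0 ≤ cP := integral_nonneg fun y => hPnn _
  -- the scaled energy `E` and the kernel integral `g(s) = s⁻² G(s)`
  set En : ℝ → ℝ := fun s => ∫ x, ‖w x‖ ^ 2 * (s⁻¹ * Pb (‖x - x₀‖ ^ 2 / s ^ 2)) with hEn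
  set g : ℝ → ℝ := fun s => (s ^ 2)⁻¹ *
    ∫ x, ‖w x‖ ^ 2 * (2 * Pb (‖x - x₀‖ ^ 2 / s ^ 2) - 3 * P (‖x - x₀‖ ^ 2 / s ^ 2)) with hg
  have hEdiff : En S - En r = ∫ s in Ioc r S, g s := by
    have h := scaledEnergy_sub_eq_integral hP hPb hode hPnn hPle hPble hw hL2 x₀ hr hrS'
    rw [intervalIntegral.integral_of_le hrS'] at h
    exact h
  have hEr : 0 ≤ En r :=
    integral_nonneg fun x => mul_nonneg (sq_nonneg _) (mul_nonneg (inv_nonneg.2 hr.le) (hPbnn _))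
  -- the defect density `F(s, x) = s⁻² D_s(x)`
  set F : ℝ → EuclideanSpace ℝ (Fin 3) → ℝ := fun s x => (s ^ 2)⁻¹ *
    (2 * (-deriv Pb (‖x - x₀‖ ^ 2 / s ^ 2)) / s ^ 2 * (‖x - x₀‖ ^ 2 * ‖w x‖ ^ 2 - ⟪x - x₀, w x⟫ ^ 2))
    with hF
  have hFnn : ∀ s x, 0 ≤ F s x := fun s x =>
    mul_nonneg (inv_nonneg.2 (sq_nonneg _)) (mul_nonneg
      (div_nonneg (mul_nonneg zero_le_two (neg_nonneg.2 (hPb' _))) (sq_nonneg _))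
      (tangentialDefect_nonneg (w x) (x - x₀)))
  have hFm : Measurable (uncurry F) := by
    simp only [hF]
    fun_prop
  -- Step 1: at each scale, `∫ F(s,·) ≤ g(s) + 3 K c_P s`
  have hstep1 : ∀ s ∈ Ioc r S, Integrable (F s) ∧ ∫ x, F s x ≤ g s + 3 * K * cP * s := by
    intro s hs
    have hs0 : 0 < s := hr.trans hs.1
    obtain ⟨hDint, hid⟩ := integral_kernel_eq_pressure_add_tangential hP hPb hode hP0 hPnn hPle hPble
      hw hL2 x₀ hs0
    have hfl := neg_integral_pressure_probe_le_of_floor hP hP0 hPnn hw hL2 x₀ hfloor hs0 hs.2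
    refine ⟨hDint.const_mul _, ?_⟩
    simp only [hF]
    rw [integral_const_mul, ← hid, hg]
    have hs2 : 0 < (s ^ 2)⁻¹ := by positivity
    have e : 3 * K * cP * s = (s ^ 2)⁻¹ * (3 * K * cP * s ^ 3) := by field_simp
    rw [e, ← mul_add]
    refine mul_le_mul_of_nonneg_left ?_ hs2.le
    linarith
  -- Step 2: `g` is integrable on `(r, S]`
  set ν : Measure ℝ := volume.restrict (Ioc r S) with hν
  haveI : IsFiniteMeasure ν := by rw [hν]; infer_instance
  set f : ℝ × EuclideanSpace ℝ (Fin 3) → ℝ := fun z =>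
    ‖w z.2‖ ^ 2 * ((z.1 ^ 2)⁻¹ * (2 * Pb (‖z.2 - x₀‖ ^ 2 / z.1 ^ 2) - 3 * P (‖z.2 - x₀‖ ^ 2 / z.1 ^ 2)))
    with hf
  have hfm : Measurable f := by
    simp only [hf]
    fun_prop
  have hbound : ∀ s ∈ Ioc r S, ∀ x, ‖f (s, x)‖ ≤ (5 * (r ^ 2)⁻¹) * ‖w x‖ ^ 2 := by
    intro s hs x
    have hs0 : 0 < s := lt_of_lt_of_le hr hs.1.le
    simp only [hf, Real.norm_eq_abs]
    rw [abs_mul, abs_of_nonneg (sq_nonneg _), abs_mul, abs_of_nonneg (by positivity)]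
    have h5 : |2 * Pb (‖x - x₀‖ ^ 2 / s ^ 2) - 3 * P (‖x - x₀‖ ^ 2 / s ^ 2)| ≤ 5 := by
      rw [abs_le]; constructor <;> nlinarith [hPbnn (‖x - x₀‖ ^ 2 / s ^ 2),
        hPble (‖x - x₀‖ ^ 2 / s ^ 2), hPnn (‖x - x₀‖ ^ 2 / s ^ 2), hPle (‖x - x₀‖ ^ 2 / s ^ 2)]
    have hrs : (s ^ 2)⁻¹ ≤ (r ^ 2)⁻¹ := by
      apply inv_anti₀ (by positivity)
      exact pow_le_pow_left₀ hr.le hs.1.le 2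
    calc ‖w x‖ ^ 2 * ((s ^ 2)⁻¹ * |2 * Pb (‖x - x₀‖ ^ 2 / s ^ 2) - 3 * P (‖x - x₀‖ ^ 2 / s ^ 2)|)
        ≤ ‖w x‖ ^ 2 * ((r ^ 2)⁻¹ * 5) := by gcongr
      _ = 5 * (r ^ 2)⁻¹ * ‖w x‖ ^ 2 := by ring
  have hprod : Integrable f (ν.prod (volume : Measure (EuclideanSpace ℝ (Fin 3)))) := by
    have hdom : Integrable (fun z : ℝ × EuclideanSpace ℝ (Fin 3) => (5 * (r ^ 2)⁻¹) * ‖w z.2‖ ^ 2)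
        (ν.prod (volume : Measure (EuclideanSpace ℝ (Fin 3)))) := by
      have := (integrable_const (5 * (r ^ 2)⁻¹) (μ := ν)).mul_prod hL2
      simpa using this
    refine hdom.mono' hfm.aestronglyMeasurable ?_
    have hmem : ∀ᵐ z ∂(ν.prod (volume : Measure (EuclideanSpace ℝ (Fin 3)))), z.1 ∈ Ioc r S :=
      (Measure.quasiMeasurePreserving_fst (μ := ν) (ν := (volume : Measure (EuclideanSpace ℝ (Fin 3))))).ae
        (by rw [hν]; exact ae_restrict_mem measurableSet_Ioc)
    filter_upwards [hmem] with z hz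
    exact hbound z.1 hz z.2
  have hgint : Integrable g ν := by
    have h := hprod.integral_prod_left
    refine h.congr (Eventually.of_forall fun s => ?_)
    simp only [hf, hg]
    rw [← integral_const_mul]
    refine integral_congr_ae (Eventually.of_forall fun x => ?_)
    ring
  -- Step 3: the scale integral of `∫ F` is at most `E(S) + (3/2) K c_P S²`
  have hL : ∫⁻ s in Ioo r S, ENNReal.ofReal (∫ x, F s x) ≤
      ENNReal.ofReal (En S + 3 / 2 * K * cP * S ^ 2) := by
    have hlinint : IntegrableOn (fun s : ℝ => 3 * K * cP * s) (Ioc r S) :=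
      (continuous_const.mul continuous_id).integrableOn_Icc.mono_set Ioc_subset_Icc_self
    have hsum : IntegrableOn (fun s => g s + 3 * K * cP * s) (Ioc r S) := hgint.add hlinint
    calc ∫⁻ s in Ioo r S, ENNReal.ofReal (∫ x, F s x)
        ≤ ∫⁻ s in Ioo r S, ENNReal.ofReal (g s + 3 * K * cP * s) := by
          refine lintegral_mono_ae ?_
          filter_upwards [ae_restrict_mem measurableSet_Ioo] with s hs
          exact ENNReal.ofReal_le_ofReal (hstep1 s ⟨hs.1, hs.2.le⟩).2
      _ = ∫⁻ s in Ioc r S, ENNReal.ofReal (g s + 3 * K * cP * s) := by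
          rw [← restrict_Ioo_eq_restrict_Ioc]
      _ = ENNReal.ofReal (∫ s in Ioc r S, (g s + 3 * K * cP * s)) := by
          rw [ofReal_integral_eq_lintegral_ofReal hsum ?_]
          filter_upwards [ae_restrict_mem measurableSet_Ioc] with s hs
          exact (integral_nonneg (hFnn s)).trans (hstep1 s hs).2
      _ ≤ ENNReal.ofReal (En S + 3 / 2 * K * cP * S ^ 2) := by
          refine ENNReal.ofReal_le_ofReal ?_
          rw [integral_add hgint hlinint, ← hEdiff]
          have hlin : ∫ s in Ioc r S, 3 * K * cP * s = 3 * K * cP * ((S ^ 2 - r ^ 2) / 2) := by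
            rw [← intervalIntegral.integral_of_le hrS', intervalIntegral.integral_const_mul, integral_id]
          rw [hlin]
          nlinarith [mul_nonneg (mul_nonneg hK hcP0) (sq_nonneg r)]
  -- Step 4: Tonelli
  have hswap : ∫⁻ s in Ioo r S, ∫⁻ x, ENNReal.ofReal (F s x) =
      ∫⁻ x, ∫⁻ s in Ioo r S, ENNReal.ofReal (F s x) := by
    refine lintegral_lintegral_swap ?_
    exact (ENNReal.measurable_ofReal.comp hFm).aemeasurable
  have hinner : ∀ s ∈ Ioo r S, ∫⁻ x, ENNReal.ofReal (F s x) = ENNReal.ofReal (∫ x, F s x) := by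
    intro s hs
    rw [ofReal_integral_eq_lintegral_ofReal (hstep1 s ⟨hs.1, hs.2.le⟩).1
      (Eventually.of_forall (hFnn s))]
  have hL' : ∫⁻ x, ∫⁻ s in Ioo r S, ENNReal.ofReal (F s x) ≤
      ENNReal.ofReal (En S + 3 / 2 * K * cP * S ^ 2) := by
    rw [← hswap]
    refine le_trans (le_of_eq ?_) hL
    refine setLIntegral_congr_fun measurableSet_Ioo fun s hs => hinner s hs
  -- Step 5: the inner scale integral on the annulus
  set A : Set (EuclideanSpace ℝ (Fin 3)) := {x | 2 * r ≤ ‖x - x₀‖ ∧ ‖x - x₀‖ ≤ S} with hA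
  have hlow : ∀ x ∈ A, ENNReal.ofReal (9 / 8 * Pb 1 *
      ((‖w x‖ ^ 2 - ⟪x - x₀, w x⟫ ^ 2 / ‖x - x₀‖ ^ 2) / ‖x - x₀‖)) ≤
      ∫⁻ s in Ioo r S, ENNReal.ofReal (F s x) := by
    intro x hx
    obtain ⟨hx1, hx2⟩ := hx
    have hρ0 : 0 < ‖x - x₀‖ := by linarith
    have hρ0' : ‖x - x₀‖ ≠ 0 := hρ0.ne'
    -- restrict the scales to `(r, ρ)` where `F` is explicit
    have hsub : Ioo r ‖x - x₀‖ ⊆ Ioo r S := Ioo_subset_Ioo le_rfl hx2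
    refine le_trans ?_ (lintegral_mono_set hsub)
    have hexp : ∀ s ∈ Ioo r ‖x - x₀‖, F s x =
        (‖x - x₀‖ ^ 2 * ‖w x‖ ^ 2 - ⟪x - x₀, w x⟫ ^ 2) * (3 * Pb 1 * s / ‖x - x₀‖ ^ 5) := by
      intro s hs
      have hs0 : 0 < s := hr.trans hs.1
      have key := inv_sq_mul_defectWeight_eq (hPb.differentiable (by simp)) hode hP0 hPbpos hs0 hs.2.le
      rw [← key]
      simp only [hF]
      ring
    have hdef := tangentialDefect_nonneg (w x) (x - x₀)
    calc ENNReal.ofReal (9 / 8 * Pb 1 * ((‖w x‖ ^ 2 - ⟪x - x₀, w x⟫ ^ 2 / ‖x - x₀‖ ^ 2) / ‖x - x₀‖))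
        = ENNReal.ofReal (‖x - x₀‖ ^ 2 * ‖w x‖ ^ 2 - ⟪x - x₀, w x⟫ ^ 2) *
            ENNReal.ofReal (9 / 8 * Pb 1 / ‖x - x₀‖ ^ 3) := by
          rw [← ENNReal.ofReal_mul hdef]
          congr 1
          field_simp
      _ ≤ ENNReal.ofReal (‖x - x₀‖ ^ 2 * ‖w x‖ ^ 2 - ⟪x - x₀, w x⟫ ^ 2) *
            ∫⁻ s in Ioo r ‖x - x₀‖, ENNReal.ofReal (3 * Pb 1 * s / ‖x - x₀‖ ^ 5) := by
          gcongr
          exact lintegral_scale_lower (hPbpos 1) hr hx1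
      _ = ∫⁻ s in Ioo r ‖x - x₀‖, ENNReal.ofReal (‖x - x₀‖ ^ 2 * ‖w x‖ ^ 2 - ⟪x - x₀, w x⟫ ^ 2) *
            ENNReal.ofReal (3 * Pb 1 * s / ‖x - x₀‖ ^ 5) := by
          rw [lintegral_const_mul]
          exact ENNReal.measurable_ofReal.comp (by fun_prop)
      _ = ∫⁻ s in Ioo r ‖x - x₀‖, ENNReal.ofReal (F s x) := by
          refine setLIntegral_congr_fun measurableSet_Ioo fun s hs => ?_
          rw [hexp s hs, ENNReal.ofReal_mul hdef]
  -- Step 6: assemble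
  have hc : 0 < 9 / 8 * Pb 1 := by have := hPbpos 1; positivity
  have hmain : ENNReal.ofReal (9 / 8 * Pb 1) *
      ∫⁻ x in A, ENNReal.ofReal ((‖w x‖ ^ 2 - ⟪x - x₀, w x⟫ ^ 2 / ‖x - x₀‖ ^ 2) / ‖x - x₀‖) ≤
      ENNReal.ofReal (En S + 3 / 2 * K * cP * S ^ 2) := by
    rw [← lintegral_const_mul' _ _ ENNReal.ofReal_ne_top]
    calc ∫⁻ x in A, ENNReal.ofReal (9 / 8 * Pb 1) *
          ENNReal.ofReal ((‖w x‖ ^ 2 - ⟪x - x₀, w x⟫ ^ 2 / ‖x - x₀‖ ^ 2) / ‖x - x₀‖)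
        ≤ ∫⁻ x in A, ∫⁻ s in Ioo r S, ENNReal.ofReal (F s x) := by
          refine setLIntegral_mono' ?_ fun x hx => ?_
          · exact (isClosed_le continuous_const (continuous_id.sub continuous_const).norm).inter
              (isClosed_le (continuous_id.sub continuous_const).norm continuous_const) |>.measurableSet
          · rw [← ENNReal.ofReal_mul hc.le]
            exact hlow x hx
      _ ≤ ∫⁻ x, ∫⁻ s in Ioo r S, ENNReal.ofReal (F s x) := setLIntegral_le_lintegral _ _
      _ ≤ ENNReal.ofReal (En S + 3 / 2 * K * cP * S ^ 2) := hL'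
  -- divide by the constant
  have hPb1 : 0 < Pb 1 := hPbpos 1
  have h89 : 0 ≤ 8 / (9 * Pb 1) := by positivity
  have e : ENNReal.ofReal (8 / (9 * Pb 1) * (En S + 3 / 2 * K * cP * S ^ 2)) =
      ENNReal.ofReal (8 / (9 * Pb 1)) * ENNReal.ofReal (En S + 3 / 2 * K * cP * S ^ 2) :=
    ENNReal.ofReal_mul h89
  rw [e]
  have hinv : ENNReal.ofReal (8 / (9 * Pb 1)) * ENNReal.ofReal (9 / 8 * Pb 1) = 1 := by
    rw [← ENNReal.ofReal_mul h89, ← ENNReal.ofReal_one]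
    congr 1
    field_simp
  calc ∫⁻ x in A, ENNReal.ofReal ((‖w x‖ ^ 2 - ⟪x - x₀, w x⟫ ^ 2 / ‖x - x₀‖ ^ 2) / ‖x - x₀‖)
      = ENNReal.ofReal (8 / (9 * Pb 1)) * (ENNReal.ofReal (9 / 8 * Pb 1) *
          ∫⁻ x in A, ENNReal.ofReal ((‖w x‖ ^ 2 - ⟪x - x₀, w x⟫ ^ 2 / ‖x - x₀‖ ^ 2) / ‖x - x₀‖)) := by
        rw [← mul_assoc, hinv, one_mul]
    _ ≤ ENNReal.ofReal (8 / (9 * Pb 1)) * ENNReal.ofReal (En S + 3 / 2 * K * cP * S ^ 2) := by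
        gcongr

end Main

/-! ### Passing to a weak limit in time (lower semicontinuity by duality) -/

section WeakLimit

/-- The tangential defect of a difference: a polarisation identity. [folklore] -/
theorem tangential_polarisation (a b y : EuclideanSpace ℝ (Fin 3)) :
    ‖a - b‖ ^ 2 - ⟪y, a - b⟫ ^ 2 / ‖y‖ ^ 2 =
      (‖a‖ ^ 2 - ⟪y, a⟫ ^ 2 / ‖y‖ ^ 2) + (‖b‖ ^ 2 - ⟪y, b⟫ ^ 2 / ‖y‖ ^ 2) -
        2 * (⟪a, b⟫ - ⟪y, a⟫ * ⟪y, b⟫ / ‖y‖ ^ 2) := by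
  have e1 : ‖a - b‖ ^ 2 = ‖a‖ ^ 2 - 2 * ⟪a, b⟫ + ‖b‖ ^ 2 := norm_sub_sq_real a b
  rw [e1, inner_sub_right]
  ring

/-- Pointwise duality inequality: `τ(a) ≥ 2⟨a, P_τ b⟩ - τ(b)`. [folklore] -/
theorem tangential_duality_le (a b y : EuclideanSpace ℝ (Fin 3)) :
    2 * (⟪a, b⟫ - ⟪y, a⟫ * ⟪y, b⟫ / ‖y‖ ^ 2) - (‖b‖ ^ 2 - ⟪y, b⟫ ^ 2 / ‖y‖ ^ 2) ≤
      ‖a‖ ^ 2 - ⟪y, a⟫ ^ 2 / ‖y‖ ^ 2 := by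
  have h : 0 ≤ ‖a - b‖ ^ 2 - ⟪y, a - b⟫ ^ 2 / ‖y‖ ^ 2 := by
    by_cases hy : y = 0
    · simp [hy]
    · have hy2 : 0 < ‖y‖ ^ 2 := by positivity
      rw [sub_nonneg, div_le_iff₀ hy2]
      linarith [tangentialDefect_nonneg (a - b) y]
  rw [tangential_polarisation] at h
  linarith

/-- The tangential defect is at most `|a|²`. [folklore] -/
theorem tangential_le_norm_sq (a y : EuclideanSpace ℝ (Fin 3)) :
    ‖a‖ ^ 2 - ⟪y, a⟫ ^ 2 / ‖y‖ ^ 2 ≤ ‖a‖ ^ 2 := by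
  have : 0 ≤ ⟪y, a⟫ ^ 2 / ‖y‖ ^ 2 := by positivity
  linarith

/-- The tangential defect is nonnegative. [folklore] -/
theorem tangential_nonneg (a y : EuclideanSpace ℝ (Fin 3)) :
    0 ≤ ‖a‖ ^ 2 - ⟪y, a⟫ ^ 2 / ‖y‖ ^ 2 := by
  by_cases hy : y = 0
  · simp [hy]
  · have hy2 : 0 < ‖y‖ ^ 2 := by positivity
    rw [sub_nonneg, div_le_iff₀ hy2]
    linarith [tangentialDefect_nonneg a y]

set_option maxHeartbeats 400000 in
/-- **Weighted tangential energies pass to weak limits in time.** If `t ↦ ∫⟪v(t), h⟫` is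
continuous on `(0, T]` for every `h ∈ L²` (weak continuity into `L²`), `v(t) ∈ L²`, and the
weighted tangential energy `∫_A wt (|v(t)|² - ⟨x-x₀,v(t)⟩²/|x-x₀|²)` (bounded measurable
weight `0 ≤ wt ≤ C`) is `≤ B` for `t ∈ (0, T)`, then it is `≤ B` at `t = T`. [folklore] -/
theorem setIntegral_tangential_final_le
    {v : ℝ → EuclideanSpace ℝ (Fin 3) → EuclideanSpace ℝ (Fin 3)} {T : ℝ} (hT : 0 < T)
    (hmem : ∀ t ∈ Icc 0 T, MemLp (v t) 2)
    (hwc : ∀ h : EuclideanSpace ℝ (Fin 3) → EuclideanSpace ℝ (Fin 3), MemLp h 2 →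
      ContinuousOn (fun t => ∫ x, ⟪v t x, h x⟫) (Ioc 0 T))
    {A : Set (EuclideanSpace ℝ (Fin 3))} (hA : MeasurableSet A)
    {wt : EuclideanSpace ℝ (Fin 3) → ℝ} (hwtm : Measurable wt) (hwt0 : ∀ x, 0 ≤ wt x) {C : ℝ}
    (hwtb : ∀ x, wt x ≤ C) (x₀ : EuclideanSpace ℝ (Fin 3)) {B : ℝ}
    (hB : ∀ t ∈ Ioo 0 T, ∫ x in A, wt x * (‖v t x‖ ^ 2 - ⟪x - x₀, v t x⟫ ^ 2 / ‖x - x₀‖ ^ 2) ≤ B) :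
    ∫ x in A, wt x * (‖v T x‖ ^ 2 - ⟪x - x₀, v T x⟫ ^ 2 / ‖x - x₀‖ ^ 2) ≤ B := by
  have hC0 : 0 ≤ C := (hwt0 x₀).trans (hwtb x₀)
  set b : EuclideanSpace ℝ (Fin 3) → EuclideanSpace ℝ (Fin 3) := v T with hb
  have hbmem : MemLp b 2 := hmem T ⟨hT.le, le_rfl⟩
  have hbL2 : Integrable fun x => ‖b x‖ ^ 2 := hbmem.integrable_norm_pow two_ne_zero
  have hbm : AEStronglyMeasurable b volume := hbmem.aestronglyMeasurable
  -- the test function `h = 1_A wt P_τ b`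
  set Pb : EuclideanSpace ℝ (Fin 3) → EuclideanSpace ℝ (Fin 3) := fun x =>
    b x - (⟪x - x₀, b x⟫ / ‖x - x₀‖ ^ 2) • (x - x₀) with hPb
  set h : EuclideanSpace ℝ (Fin 3) → EuclideanSpace ℝ (Fin 3) :=
    A.indicator fun x => wt x • Pb x with hh
  have hPbnorm : ∀ x, ‖Pb x‖ ≤ 2 * ‖b x‖ := by
    intro x
    simp only [hPb]
    by_cases hx : x - x₀ = 0
    · have e : ‖b x - (⟪x - x₀, b x⟫ / ‖x - x₀‖ ^ 2) • (x - x₀)‖ = ‖b x‖ := by rw [hx]; simp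
      rw [e]; linarith [norm_nonneg (b x)]
    · have hρ : 0 < ‖x - x₀‖ := norm_pos_iff.2 hx
      calc ‖b x - (⟪x - x₀, b x⟫ / ‖x - x₀‖ ^ 2) • (x - x₀)‖
          ≤ ‖b x‖ + ‖(⟪x - x₀, b x⟫ / ‖x - x₀‖ ^ 2) • (x - x₀)‖ := norm_sub_le _ _
        _ = ‖b x‖ + |⟪x - x₀, b x⟫| / ‖x - x₀‖ := by
            rw [norm_smul, Real.norm_eq_abs, abs_div, abs_of_nonneg (sq_nonneg ‖x - x₀‖)]
            field_simp
        _ ≤ ‖b x‖ + ‖x - x₀‖ * ‖b x‖ / ‖x - x₀‖ := by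
            gcongr; exact abs_real_inner_le_norm _ _
        _ = 2 * ‖b x‖ := by field_simp; ring
  have hbam : AEMeasurable b volume := hbm.aemeasurable
  have hym : Measurable fun x : EuclideanSpace ℝ (Fin 3) => x - x₀ := measurable_id.sub_const x₀
  have hcm : AEMeasurable (fun x : EuclideanSpace ℝ (Fin 3) => ⟪x - x₀, b x⟫ / ‖x - x₀‖ ^ 2) volume :=
    (hym.aemeasurable.inner hbam).div (hym.norm.pow_const 2).aemeasurable
  have hPbam : AEMeasurable (fun x : EuclideanSpace ℝ (Fin 3) =>
      b x - (⟪x - x₀, b x⟫ / ‖x - x₀‖ ^ 2) • (x - x₀)) volume :=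
    hbam.sub (hcm.smul hym.aemeasurable)
  have hPbm : AEStronglyMeasurable Pb volume := hPbam.aestronglyMeasurable
  have hhm : AEStronglyMeasurable h volume :=
    ((hwtm.aemeasurable.smul hPbam).indicator hA).aestronglyMeasurable
  have hhnorm : ∀ x, ‖h x‖ ≤ 2 * C * ‖b x‖ := by
    intro x
    simp only [hh]
    by_cases hx : x ∈ A
    · rw [indicator_of_mem hx, norm_smul, Real.norm_eq_abs, abs_of_nonneg (hwt0 x)]
      calc wt x * ‖Pb x‖ ≤ C * (2 * ‖b x‖) :=
            mul_le_mul (hwtb x) (hPbnorm x) (norm_nonneg _) hC0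
        _ = 2 * C * ‖b x‖ := by ring
    · rw [indicator_of_notMem hx, norm_zero]; positivity
  have hhmem : MemLp h 2 :=
    MemLp.of_le_mul hbmem hhm (Eventually.of_forall hhnorm)
  -- the pairing `F(t) = ∫ ⟪v(t), h⟫` and its value at `T`
  have hcont := hwc h hhmem
  -- integrability of the slice quantities on `A`
  have hsliceL2 : ∀ t ∈ Icc 0 T, Integrable fun x => ‖v t x‖ ^ 2 := fun t ht =>
    (hmem t ht).integrable_norm_pow two_ne_zero
  have hτint : ∀ t ∈ Icc 0 T, IntegrableOn
      (fun x => wt x * (‖v t x‖ ^ 2 - ⟪x - x₀, v t x⟫ ^ 2 / ‖x - x₀‖ ^ 2)) A := by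
    intro t ht
    have hvm : AEMeasurable (v t) volume := (hmem t ht).aestronglyMeasurable.aemeasurable
    refine (((hsliceL2 t ht).const_mul C).mono' ?_ (Eventually.of_forall fun x => ?_)).integrableOn
    · exact (hwtm.aemeasurable.mul ((hvm.norm.pow_const 2).sub
        (((hym.aemeasurable.inner hvm).pow_const 2).div (hym.norm.pow_const 2).aemeasurable))).aestronglyMeasurable
    · rw [Real.norm_eq_abs, abs_mul, abs_of_nonneg (hwt0 x), abs_of_nonneg (tangential_nonneg _ _)]
      exact mul_le_mul (hwtb x) (tangential_le_norm_sq _ _) (tangential_nonneg _ _) hC0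
  -- the pairing integrand: `⟪v t x, h x⟫ = 1_A wt (⟪a, b⟫ - ⟪y, a⟫⟪y, b⟫/|y|²)`
  have hpair : ∀ t x, ⟪v t x, h x⟫ =
      A.indicator (fun x => wt x * (⟪v t x, b x⟫ - ⟪x - x₀, v t x⟫ * ⟪x - x₀, b x⟫ / ‖x - x₀‖ ^ 2)) x := by
    intro t x
    simp only [hh]
    by_cases hx : x ∈ A
    · rw [indicator_of_mem hx, indicator_of_mem hx, real_inner_smul_right]
      simp only [hPb]
      rw [inner_sub_right, real_inner_smul_right, real_inner_comm (v t x) (x - x₀)]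
      ring
    · rw [indicator_of_notMem hx, indicator_of_notMem hx, inner_zero_right]
  have hF : ∀ t, ∫ x, ⟪v t x, h x⟫ =
      ∫ x in A, wt x * (⟪v t x, b x⟫ - ⟪x - x₀, v t x⟫ * ⟪x - x₀, b x⟫ / ‖x - x₀‖ ^ 2) := by
    intro t
    rw [← integral_indicator hA]
    exact integral_congr_ae (Eventually.of_forall (hpair t))
  -- at `t = T` the pairing is the tangential energy
  have hFT : ∫ x, ⟪v T x, h x⟫ = ∫ x in A, wt x * (‖v T x‖ ^ 2 - ⟪x - x₀, v T x⟫ ^ 2 / ‖x - x₀‖ ^ 2) := by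
    rw [hF T]
    refine integral_congr_ae (Eventually.of_forall fun x => ?_)
    show wt x * (⟪v T x, b x⟫ - ⟪x - x₀, v T x⟫ * ⟪x - x₀, b x⟫ / ‖x - x₀‖ ^ 2) =
      wt x * (‖v T x‖ ^ 2 - ⟪x - x₀, v T x⟫ ^ 2 / ‖x - x₀‖ ^ 2)
    simp only [hb, real_inner_self_eq_norm_sq]
    ring
  -- for `t < T`: `2 F(t) - Φ(T) ≤ Φ(t) ≤ B`
  have hineq : ∀ t ∈ Ioo 0 T, 2 * (∫ x, ⟪v t x, h x⟫) -
      (∫ x in A, wt x * (‖v T x‖ ^ 2 - ⟪x - x₀, v T x⟫ ^ 2 / ‖x - x₀‖ ^ 2)) ≤ B := by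
    intro t ht
    have htI : t ∈ Icc 0 T := ⟨ht.1.le, ht.2.le⟩
    have hTI : T ∈ Icc 0 T := ⟨hT.le, le_rfl⟩
    refine le_trans ?_ (hB t ht)
    rw [hF t]
    -- integrability of the cross term
    have hvm : AEMeasurable (v t) volume := (hmem t htI).aestronglyMeasurable.aemeasurable
    have hcross : IntegrableOn (fun x => wt x *
        (⟪v t x, b x⟫ - ⟪x - x₀, v t x⟫ * ⟪x - x₀, b x⟫ / ‖x - x₀‖ ^ 2)) A := by
      refine ((((hsliceL2 t htI).add hbL2).const_mul C).mono' ?_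
        (Eventually.of_forall fun x => ?_)).integrableOn
      · exact (hwtm.aemeasurable.mul ((hvm.inner hbam).sub
          (((hym.aemeasurable.inner hvm).mul (hym.aemeasurable.inner hbam)).div
            (hym.norm.pow_const 2).aemeasurable))).aestronglyMeasurable
      · rw [Real.norm_eq_abs, abs_mul, abs_of_nonneg (hwt0 x)]
        have hcs : |⟪v t x, b x⟫ - ⟪x - x₀, v t x⟫ * ⟪x - x₀, b x⟫ / ‖x - x₀‖ ^ 2| ≤
            ‖v t x‖ ^ 2 + ‖b x‖ ^ 2 := by
          have h1 : |⟪v t x, b x⟫| ≤ ‖v t x‖ * ‖b x‖ := abs_real_inner_le_norm _ _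
          have h2 : |⟪x - x₀, v t x⟫ * ⟪x - x₀, b x⟫ / ‖x - x₀‖ ^ 2| ≤ ‖v t x‖ * ‖b x‖ := by
            by_cases hy : x - x₀ = 0
            · rw [hy]; simp; positivity
            · have hρ : 0 < ‖x - x₀‖ := norm_pos_iff.2 hy
              rw [abs_div, abs_mul, abs_of_nonneg (sq_nonneg ‖x - x₀‖), div_le_iff₀ (by positivity)]
              calc |⟪x - x₀, v t x⟫| * |⟪x - x₀, b x⟫|
                  ≤ (‖x - x₀‖ * ‖v t x‖) * (‖x - x₀‖ * ‖b x‖) :=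
                    mul_le_mul (abs_real_inner_le_norm _ _) (abs_real_inner_le_norm _ _)
                      (abs_nonneg _) (by positivity)
                _ = ‖v t x‖ * ‖b x‖ * ‖x - x₀‖ ^ 2 := by ring
          calc |⟪v t x, b x⟫ - ⟪x - x₀, v t x⟫ * ⟪x - x₀, b x⟫ / ‖x - x₀‖ ^ 2|
              ≤ |⟪v t x, b x⟫| + |⟪x - x₀, v t x⟫ * ⟪x - x₀, b x⟫ / ‖x - x₀‖ ^ 2| := abs_sub _ _
            _ ≤ ‖v t x‖ * ‖b x‖ + ‖v t x‖ * ‖b x‖ := add_le_add h1 h2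
            _ ≤ ‖v t x‖ ^ 2 + ‖b x‖ ^ 2 := by nlinarith [sq_nonneg (‖v t x‖ - ‖b x‖)]
        exact mul_le_mul (hwtb x) hcs (abs_nonneg _) hC0
    have hlhs : 2 * (∫ x in A, wt x * (⟪v t x, b x⟫ - ⟪x - x₀, v t x⟫ * ⟪x - x₀, b x⟫ / ‖x - x₀‖ ^ 2)) -
        (∫ x in A, wt x * (‖v T x‖ ^ 2 - ⟪x - x₀, v T x⟫ ^ 2 / ‖x - x₀‖ ^ 2)) =
        ∫ x in A, (2 * (wt x * (⟪v t x, b x⟫ - ⟪x - x₀, v t x⟫ * ⟪x - x₀, b x⟫ / ‖x - x₀‖ ^ 2)) -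
          wt x * (‖v T x‖ ^ 2 - ⟪x - x₀, v T x⟫ ^ 2 / ‖x - x₀‖ ^ 2)) := by
      rw [integral_sub (hcross.const_mul 2) (hτint T hTI), integral_const_mul]
    rw [hlhs]
    refine integral_mono_ae ((hcross.const_mul 2).sub (hτint T hTI)) (hτint t htI)
      (Eventually.of_forall fun x => ?_)
    have := tangential_duality_le (v t x) (b x) (x - x₀)
    show 2 * (wt x * (⟪v t x, b x⟫ - ⟪x - x₀, v t x⟫ * ⟪x - x₀, b x⟫ / ‖x - x₀‖ ^ 2)) -
        wt x * (‖v T x‖ ^ 2 - ⟪x - x₀, v T x⟫ ^ 2 / ‖x - x₀‖ ^ 2) ≤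
      wt x * (‖v t x‖ ^ 2 - ⟪x - x₀, v t x⟫ ^ 2 / ‖x - x₀‖ ^ 2)
    simp only [hb] at this ⊢
    nlinarith [hwt0 x]
  -- pass to the limit `t → T⁻`
  have htend : Tendsto (fun t => ∫ x, ⟪v t x, h x⟫) (𝓝[<] T) (𝓝 (∫ x, ⟪v T x, h x⟫)) := by
    have h1 : ContinuousWithinAt (fun t => ∫ x, ⟪v t x, h x⟫) (Ioc 0 T) T := hcont T ⟨hT, le_rfl⟩
    have h2 : Tendsto (fun t => ∫ x, ⟪v t x, h x⟫) (𝓝[Ioc 0 T] T) (𝓝 (∫ x, ⟪v T x, h x⟫)) := h1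
    rw [nhdsWithin_Ioc_eq_nhdsLE hT] at h2
    exact h2.mono_left (nhdsWithin_mono _ Iio_subset_Iic_self)
  have hev : ∀ᶠ t in 𝓝[<] T, 2 * (∫ x, ⟪v t x, h x⟫) -
      (∫ x in A, wt x * (‖v T x‖ ^ 2 - ⟪x - x₀, v T x⟫ ^ 2 / ‖x - x₀‖ ^ 2)) ≤ B := by
    filter_upwards [Ioo_mem_nhdsLT hT] with t ht using hineq t ht
  have hlim := le_of_tendsto ((htend.const_mul 2).sub_const
    (∫ x in A, wt x * (‖v T x‖ ^ 2 - ⟪x - x₀, v T x⟫ ^ 2 / ‖x - x₀‖ ^ 2))) hev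
  rw [hFT] at hlim
  linarith

end WeakLimit

/-! ### The tangential energy at the final time of a classical Leray–Hopf solution -/

section Final

/-- **The tangential log-energy bound at the final time.** For a classical solution on
`[0, T) × ℝ³` which is Leray–Hopf on `[0, T]`, with the pressure floor `p̃ ≥ -K`, and any
centre `x₀`: the log-weighted tangential energy of the final value `u(T)` around `x₀` is
finite — with a bound on every annulus `{2r ≤ |x - x₀| ≤ 1}` (real integrals) and on the
punctured unit ball (lower Lebesgue integral). [cite: SereginSverak2002, §4] -/
theorem exists_tangential_final_bound {ν T : ℝ} (hν : 0 ≤ ν) (hT : 0 < T)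
    {u : ℝ → EuclideanSpace ℝ (Fin 3) → EuclideanSpace ℝ (Fin 3)}
    {p : ℝ → EuclideanSpace ℝ (Fin 3) → ℝ}
    (hsol : IsClassicalNSSolutionOn (Ico 0 T) ν 0 u p) (hLH : IsLerayHopfOn T ν 0 (u 0) u)
    {K : ℝ} (hK : 0 ≤ K) (hfloor : ∀ t ∈ Ioo 0 T, ∀ x, -K ≤ normalisedPressure (u t) x)
    (x₀ : EuclideanSpace ℝ (Fin 3)) :
    ∃ B : ℝ, 0 ≤ B ∧
      (∀ r : ℝ, 0 < r → 2 * r ≤ 1 →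
        ∫ x in {x : EuclideanSpace ℝ (Fin 3) | 2 * r ≤ ‖x - x₀‖ ∧ ‖x - x₀‖ ≤ 1},
          (‖u T x‖ ^ 2 - ⟪x - x₀, u T x⟫ ^ 2 / ‖x - x₀‖ ^ 2) / ‖x - x₀‖ ≤ B) ∧
      ∫⁻ x in ball x₀ 1, ENNReal.ofReal
          ((‖u T x‖ ^ 2 - ⟪x - x₀, u T x⟫ ^ 2 / ‖x - x₀‖ ^ 2) / ‖x - x₀‖) ≤ ENNReal.ofReal B := by
  obtain ⟨P, Pb, hP, hPb, hPnn, hPle, hPble, hPbpos, -, -, hP0, hPb', hode⟩ := exists_pressureProbePair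
  set cP : ℝ := ∫ y : EuclideanSpace ℝ (Fin 3), P (‖y‖ ^ 2) with hcP
  have hcP0 : 0 ≤ cP := integral_nonneg fun y => hPnn _
  have hPb1 : 0 < Pb 1 := hPbpos 1
  set E0 : ℝ := ∫ x, ‖u 0 x‖ ^ 2 with hE0
  have hE00 : 0 ≤ E0 := integral_nonneg fun x => sq_nonneg _
  set B : ℝ := 8 / (9 * Pb 1) * (E0 + 3 / 2 * K * cP * 1 ^ 2) with hB
  have hB0 : 0 ≤ B := by positivity
  -- the tangential density of a slice
  set τ : ℝ → EuclideanSpace ℝ (Fin 3) → ℝ := fun t x =>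
    (‖u t x‖ ^ 2 - ⟪x - x₀, u t x⟫ ^ 2 / ‖x - x₀‖ ^ 2) / ‖x - x₀‖ with hτ
  have hτnn : ∀ t x, 0 ≤ τ t x := fun t x => div_nonneg (tangential_nonneg _ _) (norm_nonneg _)
  set A : ℝ → Set (EuclideanSpace ℝ (Fin 3)) := fun r => {x | 2 * r ≤ ‖x - x₀‖ ∧ ‖x - x₀‖ ≤ 1} with hA
  have hAm : ∀ r, MeasurableSet (A r) := fun r =>
    ((isClosed_le continuous_const (continuous_id.sub continuous_const).norm).inter
      (isClosed_le (continuous_id.sub continuous_const).norm continuous_const)).measurableSet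
  -- Step 1: the bound for `t < T` on every annulus (lower integral)
  have hstep1 : ∀ t ∈ Ioo 0 T, ∀ r, 0 < r → 2 * r ≤ 1 →
      ∫⁻ x in A r, ENNReal.ofReal (τ t x) ≤ ENNReal.ofReal B := by
    intro t ht r hr hr1
    have hw : ContDiff ℝ ∞ (u t) := hsol.contDiff_velocity ⟨ht.1.le, ht.2⟩
    have htI : t ∈ Icc 0 T := ⟨ht.1.le, ht.2.le⟩
    have hL2 : Integrable fun x => ‖u t x‖ ^ 2 := (hLH.memLp t htI).integrable_norm_pow two_ne_zero
    have hEn := integral_norm_sq_le_of_isLerayHopfOn hν hLH htI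
    have h := lintegral_tangential_le hP hPb hode hP0 hPnn hPle hPble hPb' hPbpos hw hL2 x₀ hK hr hr1
      (fun x _ => hfloor t ht x)
    refine h.trans (ENNReal.ofReal_le_ofReal ?_)
    simp only [hB]
    refine mul_le_mul_of_nonneg_left ?_ (by positivity)
    have hE1 : ∫ x, ‖u t x‖ ^ 2 * ((1 : ℝ)⁻¹ * Pb (‖x - x₀‖ ^ 2 / 1 ^ 2)) ≤ E0 := by
      refine le_trans (integral_mono_of_nonneg (Eventually.of_forall fun x => ?_) hL2
        (Eventually.of_forall fun x => ?_)) hEn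
      · exact mul_nonneg (sq_nonneg _) (mul_nonneg (by norm_num) ((hPnn _).trans (hPle _)))
      · show ‖u t x‖ ^ 2 * ((1 : ℝ)⁻¹ * Pb (‖x - x₀‖ ^ 2 / 1 ^ 2)) ≤ ‖u t x‖ ^ 2
        rw [inv_one, one_mul]
        exact mul_le_of_le_one_right (sq_nonneg _) (hPble _)
    linarith
  -- Step 2: real-integral form for `t < T`
  have hτm : ∀ t ∈ Icc 0 T, AEStronglyMeasurable (τ t) volume := by
    intro t ht
    have hvm : AEMeasurable (u t) volume := (hLH.memLp t ht).aestronglyMeasurable.aemeasurable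
    have hym : Measurable fun x : EuclideanSpace ℝ (Fin 3) => x - x₀ := measurable_id.sub_const x₀
    exact (((hvm.norm.pow_const 2).sub (((hym.aemeasurable.inner hvm).pow_const 2).div
      (hym.norm.pow_const 2).aemeasurable)).div hym.norm.aemeasurable).aestronglyMeasurable
  have hstep2 : ∀ t ∈ Ioo 0 T, ∀ r, 0 < r → 2 * r ≤ 1 → ∫ x in A r, τ t x ≤ B := by
    intro t ht r hr hr1
    rw [integral_eq_lintegral_of_nonneg_ae (Eventually.of_forall (hτnn t))
      ((hτm t ⟨ht.1.le, ht.2.le⟩).restrict)]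
    exact ENNReal.toReal_le_of_le_ofReal hB0 (hstep1 t ht r hr hr1)
  -- Step 3: pass to `t = T` on every annulus, with the bounded weight `|x - x₀|⁻¹ ∧ (2r)⁻¹`
  have hstep3 : ∀ r, 0 < r → 2 * r ≤ 1 → ∫ x in A r, τ T x ≤ B := by
    intro r hr hr1
    set wt : EuclideanSpace ℝ (Fin 3) → ℝ := fun x => min ‖x - x₀‖⁻¹ (2 * r)⁻¹ with hwt
    have hwtm : Measurable wt :=
      ((continuous_id.sub continuous_const).norm.measurable.inv).min measurable_const
    have hwt0 : ∀ x, 0 ≤ wt x := fun x => le_min (inv_nonneg.2 (norm_nonneg _)) (by positivity)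
    have hwtb : ∀ x, wt x ≤ (2 * r)⁻¹ := fun x => min_le_right _ _
    have hwtA : ∀ x ∈ A r, wt x = ‖x - x₀‖⁻¹ := by
      intro x hx
      refine min_eq_left ?_
      exact inv_anti₀ (by positivity) hx.1
    have heq : ∀ t, ∫ x in A r, wt x * (‖u t x‖ ^ 2 - ⟪x - x₀, u t x⟫ ^ 2 / ‖x - x₀‖ ^ 2) =
        ∫ x in A r, τ t x := by
      intro t
      refine setIntegral_congr_fun (hAm r) fun x hx => ?_
      simp only [hτ, hwtA x hx]
      ring
    have hwc : ∀ h : EuclideanSpace ℝ (Fin 3) → EuclideanSpace ℝ (Fin 3), MemLp h 2 →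
        ContinuousOn (fun t => ∫ x, ⟪u t x, h x⟫) (Ioc 0 T) := fun h hh => (hLH.weak_continuous h hh).1
    have h := setIntegral_tangential_final_le (v := u) hT hLH.memLp hwc (hAm r) hwtm hwt0 hwtb x₀
      (B := B) (fun t ht => by rw [heq t]; exact hstep2 t ht r hr hr1)
    rw [heq T] at h
    exact h
  refine ⟨B, hB0, fun r hr hr1 => hstep3 r hr hr1, ?_⟩
  -- Step 4: exhaust the punctured ball by annuli
  have hTI : T ∈ Icc 0 T := ⟨hT.le, le_rfl⟩
  have hL2T : Integrable fun x => ‖u T x‖ ^ 2 := (hLH.memLp T hTI).integrable_norm_pow two_ne_zero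
  have hintA : ∀ r, 0 < r → IntegrableOn (τ T) (A r) := by
    intro r hr
    refine Integrable.mono' ((hL2T.const_mul (2 * r)⁻¹).integrableOn) (hτm T hTI).restrict ?_
    filter_upwards [ae_restrict_mem (hAm r)] with x hx
    rw [Real.norm_eq_abs, abs_of_nonneg (hτnn T x)]
    have hρ : 2 * r ≤ ‖x - x₀‖ := hx.1
    have hρ0 : 0 < ‖x - x₀‖ := by linarith
    simp only [hτ]
    rw [div_le_iff₀ hρ0]
    calc ‖u T x‖ ^ 2 - ⟪x - x₀, u T x⟫ ^ 2 / ‖x - x₀‖ ^ 2 ≤ ‖u T x‖ ^ 2 := tangential_le_norm_sq _ _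
      _ = (2 * r)⁻¹ * ‖u T x‖ ^ 2 * (2 * r) := by field_simp
      _ ≤ (2 * r)⁻¹ * ‖u T x‖ ^ 2 * ‖x - x₀‖ := by gcongr
  have hpiece : ∀ r, 0 < r → 2 * r ≤ 1 → ∫⁻ x in A r, ENNReal.ofReal (τ T x) ≤ ENNReal.ofReal B := by
    intro r hr hr1
    rw [← ofReal_integral_eq_lintegral_ofReal (hintA r hr) (Eventually.of_forall (hτnn T))]
    exact ENNReal.ofReal_le_ofReal (hstep3 r hr hr1)
  -- the annuli `A(r_n)`, `r_n = 1/(2(n+2))`, exhaust the punctured unit ball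
  set rs : ℕ → ℝ := fun n => 1 / (2 * ((n : ℝ) + 2)) with hrs
  have hrs0 : ∀ n, 0 < rs n := fun n => by simp only [hrs]; positivity
  have hrs1 : ∀ n, 2 * rs n ≤ 1 := fun n => by
    simp only [hrs]
    rw [show 2 * (1 / (2 * ((n : ℝ) + 2))) = 1 / ((n : ℝ) + 2) by field_simp]
    rw [div_le_one (by positivity)]
    linarith [(Nat.cast_nonneg n : (0 : ℝ) ≤ n)]
  have hmono : ∀ m n, m ≤ n → A (rs m) ⊆ A (rs n) := by
    intro m n hmn x hx
    refine ⟨le_trans ?_ hx.1, hx.2⟩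
    simp only [hrs]
    have : (m : ℝ) ≤ n := by exact_mod_cast hmn
    rw [show 2 * (1 / (2 * ((m : ℝ) + 2))) = 1 / ((m : ℝ) + 2) by field_simp,
      show 2 * (1 / (2 * ((n : ℝ) + 2))) = 1 / ((n : ℝ) + 2) by field_simp]
    exact one_div_le_one_div_of_le (by positivity) (by linarith)
  have hcover : ball x₀ 1 \ {x₀} ⊆ ⋃ n, A (rs n) := by
    rintro x ⟨hx, hx0⟩
    rw [mem_ball, dist_eq_norm] at hx
    have hρ : 0 < ‖x - x₀‖ := norm_pos_iff.2 (sub_ne_zero.2 hx0)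
    obtain ⟨n, hn⟩ := exists_nat_one_div_lt hρ
    refine mem_iUnion.2 ⟨n, ?_, hx.le⟩
    simp only [hrs]
    rw [show 2 * (1 / (2 * ((n : ℝ) + 2))) = 1 / ((n : ℝ) + 2) by field_simp]
    have : (1 : ℝ) / ((n : ℝ) + 2) ≤ 1 / ((n : ℝ) + 1) :=
      one_div_le_one_div_of_le (by positivity) (by linarith)
    linarith
  -- remove the centre (a null set), then monotone convergence over the annuli
  have hae : (ball x₀ 1 \ {x₀} : Set (EuclideanSpace ℝ (Fin 3))) =ᵐ[volume] (ball x₀ 1 : Set _) := by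
    rw [sdiff_ae_eq_self]
    exact measure_mono_null inter_subset_right (measure_singleton x₀)
  set f : EuclideanSpace ℝ (Fin 3) → ℝ≥0∞ := fun x => ENNReal.ofReal (τ T x) with hf
  have hfm : AEMeasurable f volume := (hτm T hTI).aemeasurable.ennreal_ofReal
  calc ∫⁻ x in ball x₀ 1, f x = ∫⁻ x in ball x₀ 1 \ {x₀}, f x := (setLIntegral_congr hae).symm
    _ ≤ ∫⁻ x in ⋃ n, A (rs n), f x := lintegral_mono_set hcover
    _ = ∫⁻ x, (⋃ n, A (rs n)).indicator f x := (lintegral_indicator (MeasurableSet.iUnion fun n => hAm _) _).symm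
    _ = ∫⁻ x, ⨆ n, (A (rs n)).indicator f x := by
        refine lintegral_congr fun x => ?_
        exact indicator_iUnion_apply rfl _ _ _
    _ = ⨆ n, ∫⁻ x, (A (rs n)).indicator f x := by
        refine lintegral_iSup' (fun n => hfm.indicator (hAm _)) (Eventually.of_forall fun x => ?_)
        intro m n hmn
        exact indicator_le_indicator_of_subset (hmono m n hmn) (fun _ => bot_le) x
    _ = ⨆ n, ∫⁻ x in A (rs n), f x := by
        congr 1; funext n; exact lintegral_indicator (hAm _) _
    _ ≤ ENNReal.ofReal B := iSup_le fun n => hpiece (rs n) (hrs0 n) (hrs1 n)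

end Final


end SereginSverak2002

end Literature.Analysis.FluidPDE

end
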